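import Summits.AnomalousDissipation.AnomalousDissipation.Theorems.DopplerClockDopplerWorkIdentity
import Summits.AnomalousDissipation.AnomalousDissipation.Theorems.DopplerClockLaminarStreaksSteady
import Literature.Analysis.FunctionSpaces.TorusCalculusProofs
import Literature.Analysis.FunctionSpaces.TorusClassicalNSUniqueness

/-!
# Stub `stub_patternTransportFacts` of the line `Sketch` (laminar-burst-shadowing)
# (crux stmt-AnomalousDissipation-18129, `DopplerClock.QuadratureStressFloor`)

PATTERN TRANSPORT FACTS — the kinematic input of the line's first lemma ("kinematic
extraction"). For the quadrature streak pattern `Ψ_s = sin(2πm x₁) sin(2πn x₂) e₀ =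
(Im e_M · Im e_N) e₀` and its conjugate `Ψ_c = sin(2πm x₁) cos(2πn x₂) e₀ = (Im e_M · Re e_N) e₀`
(`e_k = UnitAddTorus.mFourier k`, `M = m e₁`, `N = n e₂`, `e₀ = EuclideanSpace.single 0 1`) and
a smooth divergence-free field `w` on `T³`:

1. `∫ ⟪Ψ_s, (w·∇)Ψ_s⟫ = 0` — antisymmetry of the trilinear form, the tree lemma
   `Torus.integral_inner_convect_self_right_eq_zero`;
2. `|∫ ⟪Ψ_c, (w·∇)Ψ_s⟫| ≤ 2π(m+n) ∫ ‖w‖` — pointwise `(w·∇)Ψ(x) = ∑ᵢ wᵢ(x) ∂ᵢΨ(x)`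
   (`Torus.fderiv_apply_eq_sum_partialDeriv`) with `∂₀Ψ_s = 0`, `‖∂₁Ψ_s‖ ≤ 2πm`,
   `‖∂₂Ψ_s‖ ≤ 2πn` (`DopplerStreaks.partialDeriv_sinSin`, `|Re e_k|, |Im e_k| ≤ 1`), so
   `‖(w·∇)Ψ_s(x)‖ ≤ 2π(m+n) ‖w x‖`, and `‖Ψ_c x‖ ≤ 1`;
3. `|∫ ⟪w, (w·∇)Ψ_c⟫| ≤ 2π(m+n) ∫ ‖w‖²` — the same with `DopplerStreaks.partialDeriv_sinCos`;
4. `((w + aΨ_c + bΨ_s)·∇)Ψ_s = (w·∇)Ψ_s` — `(·∇)Ψ_s = DΨ_s(x)[·]` is linear and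
   `DΨ_s(x)[e₀] = ∂₀Ψ_s(x) = 0` while both patterns point along `e₀`.

References: Grafakos 2014, Prop. 3.2.6 (derivatives of characters); Majda–Bertozzi 2002, §3.1.1
(transport estimates of the basic energy method); Serrin 1959, §2. No new definitions.
-/

noncomputable section

-- `Summit.<Summit>.<Problem>` is the tree's mandated summit-side namespace (CONVENTIONS §2); for
-- this single-conjunct summit the two coincide, so the duplicate is deliberate.
set_option linter.dupNamespace false

open MeasureTheory Set Filter Topology UnitAddTorus
open scoped InnerProductSpace RealInnerProductSpace

namespace Summit.AnomalousDissipation.AnomalousDissipation.Theorems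

open Literature.Analysis.FluidPDE Literature.Analysis.FluidPDE.Torus
open Literature.Analysis.FunctionSpaces Literature.Analysis.FunctionSpaces.Torus

namespace PatternTransport

/-! ### Pointwise size of characters -/

/-- `|Re e_k| ≤ 1` (`(Re e_k)² + (Im e_k)² = 1`). [folklore] -/
theorem abs_re_mFourier_le_one (k : Fin 3 → ℤ) (x : UnitAddTorus (Fin 3)) :
    |(mFourier k x).re| ≤ 1 := by
  rw [← sq_le_one_iff_abs_le_one]
  nlinarith [DopplerWork.re_sq_add_im_sq_mFourier k x, sq_nonneg (mFourier k x).im]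

/-- `|Im e_k| ≤ 1` (`(Re e_k)² + (Im e_k)² = 1`). [folklore] -/
theorem abs_im_mFourier_le_one (k : Fin 3 → ℤ) (x : UnitAddTorus (Fin 3)) :
    |(mFourier k x).im| ≤ 1 := by
  rw [← sq_le_one_iff_abs_le_one]
  nlinarith [DopplerWork.re_sq_add_im_sq_mFourier k x, sq_nonneg (mFourier k x).re]

/-- `|c (a b)| ≤ c` for an amplitude `c ≥ 0` and two factors `|a|, |b| ≤ 1` (the size of one
term `2π kⱼ · Re/Im e_k · Re/Im e_l` of a pattern derivative). [folklore] -/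
theorem abs_const_mul_mul_le {c a b : ℝ} (hc : 0 ≤ c) (ha : |a| ≤ 1) (hb : |b| ≤ 1) :
    |c * (a * b)| ≤ c := by
  rw [abs_mul, abs_of_nonneg hc, abs_mul]
  exact mul_le_of_le_one_right hc
    ((mul_le_mul ha hb (abs_nonneg _) zero_le_one).trans_eq (one_mul 1))

/-- `‖c e₀‖ = |c|` for `e₀ = EuclideanSpace.single 0 1`. [folklore] -/
theorem norm_smul_single_zero_one (c : ℝ) :
    ‖c • EuclideanSpace.single (0 : Fin 3) (1 : ℝ)‖ = |c| := by
  rw [norm_smul, PiLp.norm_single, norm_one, mul_one, Real.norm_eq_abs]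

/-! ### The two patterns: size and size of the partial derivatives -/

/-- `‖Ψ_c x‖ ≤ 1` for the conjugate pattern `Ψ_c = sin(2πm x₁) cos(2πn x₂) e₀`. [folklore] -/
theorem norm_copattern_le_one (m n : ℕ) (x : UnitAddTorus (Fin 3)) :
    ‖((mFourier (Pi.single (1 : Fin 3) (m : ℤ)) x).im *
        (mFourier (Pi.single (2 : Fin 3) (n : ℤ)) x).re) •
        EuclideanSpace.single (0 : Fin 3) (1 : ℝ)‖ ≤ 1 := by
  rw [norm_smul_single_zero_one, abs_mul]
  exact (mul_le_mul (abs_im_mFourier_le_one _ _) (abs_re_mFourier_le_one _ _) (abs_nonneg _)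
    zero_le_one).trans_eq (one_mul 1)

/-- `∑ᵢ ‖∂ᵢ Ψ_s(x)‖ ≤ 2π(m+n)` for the streak pattern `Ψ_s = sin(2πm x₁) sin(2πn x₂) e₀`:
`∂₀Ψ_s = 0`, `∂₁Ψ_s = 2πm cos·sin e₀`, `∂₂Ψ_s = 2πn sin·cos e₀`
(`DopplerStreaks.partialDeriv_sinSin`). [folklore] -/
theorem sum_norm_partialDeriv_pattern_le (m n : ℕ) (x : UnitAddTorus (Fin 3)) :
    ∑ i, ‖partialDeriv i (fun y : UnitAddTorus (Fin 3) =>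
        ((mFourier (Pi.single (1 : Fin 3) (m : ℤ)) y).im *
          (mFourier (Pi.single (2 : Fin 3) (n : ℤ)) y).im) •
          EuclideanSpace.single (0 : Fin 3) (1 : ℝ)) x‖
      ≤ 2 * Real.pi * ((m : ℝ) + (n : ℝ)) := by
  simp only [Fin.sum_univ_three, DopplerStreaks.partialDeriv_sinSin, Pi.single_apply]
  simp only [Fin.isValue, Fin.reduceEq, if_false, if_true, Int.cast_zero, Int.cast_natCast,
    mul_zero, zero_mul, add_zero, zero_add, zero_smul, norm_zero, norm_smul_single_zero_one]
  have h1 : |2 * Real.pi * (m : ℝ) * ((mFourier (Pi.single (1 : Fin 3) (m : ℤ)) x).re *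
      (mFourier (Pi.single (2 : Fin 3) (n : ℤ)) x).im)| ≤ 2 * Real.pi * m :=
    abs_const_mul_mul_le (by positivity) (abs_re_mFourier_le_one _ _) (abs_im_mFourier_le_one _ _)
  have h2 : |2 * Real.pi * (n : ℝ) * ((mFourier (Pi.single (1 : Fin 3) (m : ℤ)) x).im *
      (mFourier (Pi.single (2 : Fin 3) (n : ℤ)) x).re)| ≤ 2 * Real.pi * n :=
    abs_const_mul_mul_le (by positivity) (abs_im_mFourier_le_one _ _) (abs_re_mFourier_le_one _ _)
  linarith

/-- `∑ᵢ ‖∂ᵢ Ψ_c(x)‖ ≤ 2π(m+n)` for the conjugate pattern `Ψ_c = sin(2πm x₁) cos(2πn x₂) e₀`: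
`∂₀Ψ_c = 0`, `∂₁Ψ_c = 2πm cos·cos e₀`, `∂₂Ψ_c = -2πn sin·sin e₀`
(`DopplerStreaks.partialDeriv_sinCos`). [folklore] -/
theorem sum_norm_partialDeriv_copattern_le (m n : ℕ) (x : UnitAddTorus (Fin 3)) :
    ∑ i, ‖partialDeriv i (fun y : UnitAddTorus (Fin 3) =>
        ((mFourier (Pi.single (1 : Fin 3) (m : ℤ)) y).im *
          (mFourier (Pi.single (2 : Fin 3) (n : ℤ)) y).re) •
          EuclideanSpace.single (0 : Fin 3) (1 : ℝ)) x‖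
      ≤ 2 * Real.pi * ((m : ℝ) + (n : ℝ)) := by
  simp only [Fin.sum_univ_three, DopplerStreaks.partialDeriv_sinCos, Pi.single_apply]
  simp only [Fin.isValue, Fin.reduceEq, if_false, if_true, Int.cast_zero, Int.cast_natCast,
    mul_zero, zero_mul, sub_zero, zero_sub, zero_smul, norm_zero, zero_add,
    norm_smul_single_zero_one, abs_neg]
  have h1 : |2 * Real.pi * (m : ℝ) * ((mFourier (Pi.single (1 : Fin 3) (m : ℤ)) x).re *
      (mFourier (Pi.single (2 : Fin 3) (n : ℤ)) x).re)| ≤ 2 * Real.pi * m :=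
    abs_const_mul_mul_le (by positivity) (abs_re_mFourier_le_one _ _) (abs_re_mFourier_le_one _ _)
  have h2 : |2 * Real.pi * (n : ℝ) * ((mFourier (Pi.single (1 : Fin 3) (m : ℤ)) x).im *
      (mFourier (Pi.single (2 : Fin 3) (n : ℤ)) x).im)| ≤ 2 * Real.pi * n :=
    abs_const_mul_mul_le (by positivity) (abs_im_mFourier_le_one _ _) (abs_im_mFourier_le_one _ _)
  linarith

/-! ### Transport of a `C¹` field by a vector field: generic bounds on `T³` -/

/-- `‖DΨ(x) v‖ ≤ (∑ᵢ ‖∂ᵢ Ψ(x)‖) ‖v‖` for `C¹` `Ψ` on `T³` (`DΨ(x) v = ∑ᵢ vᵢ ∂ᵢ Ψ(x)`,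
`Torus.fderiv_apply_eq_sum_partialDeriv`, and `|vᵢ| ≤ ‖v‖`). [folklore] -/
theorem norm_fderiv_apply_le {Ψ : UnitAddTorus (Fin 3) → EuclideanSpace ℝ (Fin 3)}
    (hΨ : IsContDiff 1 Ψ) (x : UnitAddTorus (Fin 3)) (v : EuclideanSpace ℝ (Fin 3)) :
    ‖Torus.fderiv Ψ x v‖ ≤ (∑ i, ‖partialDeriv i Ψ x‖) * ‖v‖ := by
  rw [fderiv_apply_eq_sum_partialDeriv hΨ, Finset.sum_mul]
  refine (norm_sum_le _ _).trans (Finset.sum_le_sum fun i _ => ?_)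
  rw [norm_smul, mul_comm]
  exact mul_le_mul_of_nonneg_left (PiLp.norm_apply_le v i) (norm_nonneg _)

/-- `‖(w·∇)Ψ(x)‖ ≤ C ‖w x‖` when `∑ᵢ ‖∂ᵢ Ψ‖ ≤ C` pointwise (`(w·∇)Ψ(x) = DΨ(x)[w x]`). [folklore] -/
theorem norm_convect_le {Ψ w : UnitAddTorus (Fin 3) → EuclideanSpace ℝ (Fin 3)} {C : ℝ}
    (hΨ : IsContDiff 1 Ψ) (hC : ∀ x, ∑ i, ‖partialDeriv i Ψ x‖ ≤ C) (x : UnitAddTorus (Fin 3)) :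
    ‖convect w Ψ x‖ ≤ C * ‖w x‖ :=
  (norm_fderiv_apply_le hΨ x (w x)).trans (mul_le_mul_of_nonneg_right (hC x) (norm_nonneg _))

/-- `|∫ ⟪Φ, (w·∇)Ψ⟫| ≤ C ∫ ‖w‖` for `‖Φ‖ ≤ 1`, `∑ᵢ ‖∂ᵢ Ψ‖ ≤ C` pointwise and continuous
(here: smooth) `w` (`|⟪Φ, (w·∇)Ψ⟫| ≤ ‖Φ‖ ‖(w·∇)Ψ‖ ≤ C ‖w‖` pointwise, then monotonicity of the
integral). [folklore] -/
theorem abs_integral_inner_convect_le {Φ Ψ w : UnitAddTorus (Fin 3) → EuclideanSpace ℝ (Fin 3)}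
    {C : ℝ} (hΨ : IsContDiff 1 Ψ) (hΦ : ∀ x, ‖Φ x‖ ≤ 1)
    (hC : ∀ x, ∑ i, ‖partialDeriv i Ψ x‖ ≤ C) (hw : IsSmooth w) :
    |∫ x, ⟪Φ x, convect w Ψ x⟫| ≤ C * ∫ x, ‖w x‖ := by
  rw [← integral_const_mul]
  refine abs_integral_le_integral_abs.trans (integral_mono_of_nonneg ?_ ?_ ?_)
  · exact Eventually.of_forall fun x => abs_nonneg _
  · exact (hw.continuous.norm.integrable_unitAddTorus).const_mul _
  · refine Eventually.of_forall fun x => ?_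
    calc |⟪Φ x, convect w Ψ x⟫|
        ≤ ‖Φ x‖ * ‖convect w Ψ x‖ := abs_real_inner_le_norm _ _
      _ ≤ 1 * (C * ‖w x‖) :=
          mul_le_mul (hΦ x) (norm_convect_le hΨ hC x) (norm_nonneg _) zero_le_one
      _ = C * ‖w x‖ := one_mul _

/-- `|∫ ⟪w, (w·∇)Ψ⟫| ≤ C ∫ ‖w‖²` for `∑ᵢ ‖∂ᵢ Ψ‖ ≤ C` pointwise and smooth `w`
(`|⟪w, (w·∇)Ψ⟫| ≤ ‖w‖ ‖(w·∇)Ψ‖ ≤ C ‖w‖²` pointwise; Majda–Bertozzi 2002, Prop. 3.1, the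
transport estimate of the basic energy method). [folklore] -/
theorem abs_integral_inner_self_convect_le {Ψ w : UnitAddTorus (Fin 3) → EuclideanSpace ℝ (Fin 3)}
    {C : ℝ} (hΨ : IsContDiff 1 Ψ) (hC : ∀ x, ∑ i, ‖partialDeriv i Ψ x‖ ≤ C) (hw : IsSmooth w) :
    |∫ x, ⟪w x, convect w Ψ x⟫| ≤ C * ∫ x, ‖w x‖ ^ 2 := by
  rw [← integral_const_mul]
  refine abs_integral_le_integral_abs.trans (integral_mono_of_nonneg ?_ ?_ ?_)
  · exact Eventually.of_forall fun x => abs_nonneg _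
  · exact hw.norm_sq.integrable.const_mul _
  · refine Eventually.of_forall fun x => ?_
    calc |⟪w x, convect w Ψ x⟫|
        ≤ ‖w x‖ * ‖convect w Ψ x‖ := abs_real_inner_le_norm _ _
      _ ≤ ‖w x‖ * (C * ‖w x‖) := mul_le_mul_of_nonneg_left (norm_convect_le hΨ hC x) (norm_nonneg _)
      _ = C * ‖w x‖ ^ 2 := by ring

/-- Adding multiples of `e₀`-directed fields `φ e₀`, `ψ e₀` to the transporting field does not
change `(·∇)Ψ` when `∂₀Ψ = 0`: `(·∇)Ψ(x) = DΨ(x)[·]` is linear and `DΨ(x)[e₀] = ∂₀Ψ(x) = 0`.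
[folklore] -/
theorem convect_add_smul_single_zero {Ψ : UnitAddTorus (Fin 3) → EuclideanSpace ℝ (Fin 3)}
    (hΨ : IsContDiff 1 Ψ) (h0 : ∀ x, partialDeriv 0 Ψ x = 0)
    (w : UnitAddTorus (Fin 3) → EuclideanSpace ℝ (Fin 3)) (φ ψ : UnitAddTorus (Fin 3) → ℝ)
    (a b : ℝ) :
    convect (fun y => w y + (a • (φ y • EuclideanSpace.single (0 : Fin 3) (1 : ℝ)) +
        b • (ψ y • EuclideanSpace.single (0 : Fin 3) (1 : ℝ)))) Ψ = convect w Ψ := by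
  funext x
  have he : Torus.fderiv Ψ x (EuclideanSpace.single (0 : Fin 3) (1 : ℝ)) = 0 := by
    rw [← partialDeriv_eq_fderiv_apply hΨ 0 x]
    exact h0 x
  unfold Torus.convect
  simp only [map_add, map_smul, he, smul_zero, add_zero]

end PatternTransport

/-- **Pattern transport facts** (stub `stub_patternTransportFacts` of the line `Sketch` of the crux
`DopplerClock.QuadratureStressFloor`, stmt-AnomalousDissipation-18129). For a smooth divergence-free
field `w` on `T³` and the patterns `Ψ_s = sin(2πm x₁) sin(2πn x₂) e₀`,
`Ψ_c = sin(2πm x₁) cos(2πn x₂) e₀`: (i) `∫⟪Ψ_s, (w·∇)Ψ_s⟫ = 0`;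
(ii) `|∫⟪Ψ_c, (w·∇)Ψ_s⟫| ≤ 2π(m+n) ∫‖w‖`; (iii) `|∫⟪w, (w·∇)Ψ_c⟫| ≤ 2π(m+n) ∫‖w‖²`;
(iv) `((w + aΨ_c + bΨ_s)·∇)Ψ_s = (w·∇)Ψ_s`. [folklore] -/
theorem stub_patternTransportFacts :
    ∀ (m n : ℕ) (w : UnitAddTorus (Fin 3) → EuclideanSpace ℝ (Fin 3)),
      Literature.Analysis.FunctionSpaces.Torus.IsSmooth w →
      Literature.Analysis.FunctionSpaces.Torus.IsDivFree w →
      (∫ x, inner ℝ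
          ((fun (y : UnitAddTorus (Fin 3)) => ((UnitAddTorus.mFourier (Pi.single (1 : Fin 3) (m : ℤ)) y).im *
            (UnitAddTorus.mFourier (Pi.single (2 : Fin 3) (n : ℤ)) y).im) • EuclideanSpace.single (0 : Fin 3) (1 : ℝ)) x)
          (Literature.Analysis.FunctionSpaces.Torus.convect w
            (fun (y : UnitAddTorus (Fin 3)) => ((UnitAddTorus.mFourier (Pi.single (1 : Fin 3) (m : ℤ)) y).im *
              (UnitAddTorus.mFourier (Pi.single (2 : Fin 3) (n : ℤ)) y).im) • EuclideanSpace.single (0 : Fin 3) (1 : ℝ)) x)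
        = 0) ∧
      (|∫ x, inner ℝ
          ((fun (y : UnitAddTorus (Fin 3)) => ((UnitAddTorus.mFourier (Pi.single (1 : Fin 3) (m : ℤ)) y).im *
            (UnitAddTorus.mFourier (Pi.single (2 : Fin 3) (n : ℤ)) y).re) • EuclideanSpace.single (0 : Fin 3) (1 : ℝ)) x)
          (Literature.Analysis.FunctionSpaces.Torus.convect w
            (fun (y : UnitAddTorus (Fin 3)) => ((UnitAddTorus.mFourier (Pi.single (1 : Fin 3) (m : ℤ)) y).im *
              (UnitAddTorus.mFourier (Pi.single (2 : Fin 3) (n : ℤ)) y).im) • EuclideanSpace.single (0 : Fin 3) (1 : ℝ)) x)|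
        ≤ 2 * Real.pi * ((m : ℝ) + (n : ℝ)) * ∫ x, ‖w x‖) ∧
      (|∫ x, inner ℝ (w x)
          (Literature.Analysis.FunctionSpaces.Torus.convect w
            (fun (y : UnitAddTorus (Fin 3)) => ((UnitAddTorus.mFourier (Pi.single (1 : Fin 3) (m : ℤ)) y).im *
              (UnitAddTorus.mFourier (Pi.single (2 : Fin 3) (n : ℤ)) y).re) • EuclideanSpace.single (0 : Fin 3) (1 : ℝ)) x)|
        ≤ 2 * Real.pi * ((m : ℝ) + (n : ℝ)) * ∫ x, ‖w x‖ ^ 2) ∧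
      (∀ a b : ℝ,
        Literature.Analysis.FunctionSpaces.Torus.convect
            (fun y => w y +
              (a • ((fun (y : UnitAddTorus (Fin 3)) => ((UnitAddTorus.mFourier (Pi.single (1 : Fin 3) (m : ℤ)) y).im *
                  (UnitAddTorus.mFourier (Pi.single (2 : Fin 3) (n : ℤ)) y).re) • EuclideanSpace.single (0 : Fin 3) (1 : ℝ)) y) +
               b • ((fun (y : UnitAddTorus (Fin 3)) => ((UnitAddTorus.mFourier (Pi.single (1 : Fin 3) (m : ℤ)) y).im *
                  (UnitAddTorus.mFourier (Pi.single (2 : Fin 3) (n : ℤ)) y).im) • EuclideanSpace.single (0 : Fin 3) (1 : ℝ)) y)))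
            (fun (y : UnitAddTorus (Fin 3)) => ((UnitAddTorus.mFourier (Pi.single (1 : Fin 3) (m : ℤ)) y).im *
              (UnitAddTorus.mFourier (Pi.single (2 : Fin 3) (n : ℤ)) y).im) • EuclideanSpace.single (0 : Fin 3) (1 : ℝ))
          =
        Literature.Analysis.FunctionSpaces.Torus.convect w
            (fun (y : UnitAddTorus (Fin 3)) => ((UnitAddTorus.mFourier (Pi.single (1 : Fin 3) (m : ℤ)) y).im *
              (UnitAddTorus.mFourier (Pi.single (2 : Fin 3) (n : ℤ)) y).im) • EuclideanSpace.single (0 : Fin 3) (1 : ℝ))) := by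
  intro m n w hw hdiv
  have hΨs := (DopplerWork.pattern_regular m n).1
  have hΨs1 := hΨs.isContDiff (n := 1) (by simp)
  have hΨc1 := (DopplerStreaks.sinCos_regular m n).1.isContDiff (n := 1) (by simp)
  refine ⟨?_, ?_, ?_, fun a b => ?_⟩
  · -- (i): antisymmetry of the trilinear form, `b(w, Ψ_s, Ψ_s) = 0`
    rw [← integral_inner_convect_self_right_eq_zero hw hdiv hΨs]
    exact integral_congr_ae (ae_of_all _ fun x => real_inner_comm _ _)
  · -- (ii): `‖Ψ_c‖ ≤ 1`, `‖(w·∇)Ψ_s‖ ≤ 2π(m+n)‖w‖`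
    exact PatternTransport.abs_integral_inner_convect_le hΨs1
      (PatternTransport.norm_copattern_le_one m n)
      (PatternTransport.sum_norm_partialDeriv_pattern_le m n) hw
  · -- (iii): `‖(w·∇)Ψ_c‖ ≤ 2π(m+n)‖w‖`
    exact PatternTransport.abs_integral_inner_self_convect_le hΨc1
      (PatternTransport.sum_norm_partialDeriv_copattern_le m n) hw
  · -- (iv): linearity of `DΨ_s(x)` and `DΨ_s(x)[e₀] = ∂₀Ψ_s(x) = 0`
    exact PatternTransport.convect_add_smul_single_zero hΨs1
      (DopplerStreaks.partialDeriv_zero_sinSin m n) w _ _ a b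

end Summit.AnomalousDissipation.AnomalousDissipation.Theorems

end
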